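import Mathlib.Analysis.Distribution.SchwartzSpace.Basic
import Mathlib.Analysis.Calculus.ContDiff.Bounds
import Mathlib.Analysis.Complex.Basic
import Mathlib.Data.Fin.Rev
import Literature.MathematicalPhysics.QuantumLattice.RandomField
import Literature.MathematicalPhysics.QuantumLattice.EuclideanAction
import HarnessLib

-- provenance: harness21/H21/H21/Prelude/QLatticeAQFT/SchwartzTensor.lean @ 882c699 (interim HEAD d8f2665); M5 mechanical rewrite
/-!
# Tensor products of test functions and Schwinger families

Trunk **T-AQFT** (G13, Part A, item A3), families `constructive-qft`, `crit-ising`.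
Notion: `schwinger_functions` (as tempered distributions).

Osterwalder–Schrader work with the Schwinger functions `𝔖ₙ ∈ 𝒮'(ℝ^{dn})` of a Euclidean field
theory and constantly use test functions in *separate variables*,
`(f₁ ⊗ ⋯ ⊗ fₙ)(x₁, …, xₙ) = ∏ᵢ fᵢ(xᵢ)` and `(F ⊗ G)(x, y) = F(x) G(y)`, the involution
`f*(x₁, …, xₙ) = conj f(xₙ, …, x₁)` and its time-reflected version `Θf*`. This file provides

* witness predicates (outline A-D1, R1): `IsTensorOf F f` (`F = f₁ ⊗ ⋯ ⊗ fₙ` pointwise) and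
  `IsAppendTensorOf H F G` (`H = F ⊗ G` pointwise on `Fin (n + m) → E`), so that every downstream
  statement is independent of a particular construction of the tensor product;
* `starTest` (pointwise complex conjugation, `ℝ`-linear) and the OS adjoint `osAdjoint`
  (`F ↦ conj F(θxₙ, …, θx₁)`, OS 1973 §2, (2.4) and (4.2));
* REAL constructions: `SchwartzMap.mulComp` (the product `x ↦ f (π₁ x) * g (π₂ x)` of two
  Schwartz functions pulled back along continuous linear maps that jointly control the norm is
  Schwartz — Leibniz rule + `ContinuousLinearMap.iteratedFDeriv_comp_right`),
  `SchwartzMap.appendTensor F G` and `SchwartzMap.tensorFin f`, with `isTensorOf_tensorFin`,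
  `isAppendTensorOf_appendTensor`, hence `exists_isTensorOf`, `exists_isAppendTensorOf` (all with
  real proofs);
* Schwinger families `SchwingerFamily E := (n : ℕ) → 𝓢((Fin n → E), ℂ) →L[ℂ] ℂ`, the bridge
  `IsSchwingerFamilyOf μ S` to the moments of a law `μ` on field configurations, symmetry
  `SchwingerFamily.IsSymmetric`, `SchwingerFamily.twoPoint`, and the (sorried) nuclear-theorem
  statement `existsUnique_schwingerFamilyOf`.

## Sources

* K. Osterwalder, R. Schrader, *Axioms for Euclidean Green's functions*, Comm. Math. Phys. 31
  (1973) 83–112, §2 (test function spaces, `f*`, `Θ`, `f^π`), §3 (Schwinger functions as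
  distributions), §4 (reflection positivity (E2)).
* K. Osterwalder, R. Schrader, part II, Comm. Math. Phys. 42 (1975) 281–305, §2.
* J. Glimm, A. Jaffe, *Quantum Physics: a functional integral point of view* (2nd ed. 1987),
  §6.1 (Schwinger functions as moments of a measure on `𝒮'(ℝ^d)`; nuclear theorem).
* I. M. Gel'fand, N. Ya. Vilenkin, *Generalized functions* IV, §1.3 (kernel theorem).

## Mathlib

Mathlib has the Schwartz space `𝓢(E, F)` with `SchwartzMap.seminorm`, `SchwartzMap.postcompCLM`,
`SchwartzMap.compCLMOfContinuousLinearEquiv`, `SchwartzMap.smulLeftCLM` (product with a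
temperate-growth function *on the same space*), the Leibniz bound `norm_iteratedFDeriv_mul_le` and
`ContinuousLinearMap.iteratedFDeriv_comp_right`; it has NO tensor product of Schwartz functions
in separate variables (searched: `tensor`, `prod` in `Analysis/Distribution`), no Schwartz kernel
theorem, and no conjugation operator on `𝓢(E, ℂ)`. The constructions below fill this gap in the
minimal form the AQFT statements need. Declarations `SchwartzMap.mulComp`,
`SchwartzMap.appendTensor`, `SchwartzMap.tensorFin`, `SchwartzMap.constOfSubsingleton` are
deliberate dot-notation extensions in Mathlib's `SchwartzMap` namespace.

## Design

* Scalars of the constructions are a general `RCLike 𝕜`; the witness predicates and Schwinger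
  families are complex-valued (outline §0: multi-point test functions are complex).
* `IsAppendTensorOf` splits `Fin (n + m)` with `Fin.castAdd m` / `Fin.natAdd n` (the `Fin.append`
  convention). `tensorFin` is defined by recursion on `n` through `mulComp`, splitting off the last
  variable (`Fin.castSucc` / `Fin.last`), so `isTensorOf_tensorFin` is `Fin.prod_univ_castSucc`.
* `IsSchwingerFamilyOf μ S` casts the real moment `moment μ n f : ℝ` into `ℂ`.
* `existsUnique_schwingerFamilyOf` assumes finite dimension (nuclear theorem), all moments, and
  joint continuity of `f ↦ moment μ n f`; it is a known theorem (GJ §6.1, Prop. 6.1.4 ff.), sorried.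
-/

open scoped SchwartzMap ComplexConjugate ContDiff
open MeasureTheory

noncomputable section

/-! ### Real constructions (dot-notation extensions of `SchwartzMap`) -/

namespace SchwartzMap

section MulComp

variable {𝕜 : Type*} [RCLike 𝕜]
variable {D E₁ E₂ : Type*} [NormedAddCommGroup D] [NormedSpace ℝ D]
  [NormedAddCommGroup E₁] [NormedSpace ℝ E₁] [NormedAddCommGroup E₂] [NormedSpace ℝ E₂]

/-- Key estimate for tensor products (OS 1973 §2; GJ §6.1): if `π₁, π₂` are continuous linear maps
out of `D` with `‖x‖ ≤ C * max ‖π₁ x‖ ‖π₂ x‖`, then `x ↦ f (π₁ x) * g (π₂ x)` has Schwartz decay for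
Schwartz `f`, `g`. Proof: Leibniz rule (`norm_iteratedFDeriv_mul_le`), the chain rule for linear
maps (`ContinuousLinearMap.iteratedFDeriv_comp_right`) and `SchwartzMap.le_seminorm`. [cite: OS1973, §2] -/
theorem decay_mul_comp (f : 𝓢(E₁, 𝕜)) (g : 𝓢(E₂, 𝕜)) (π₁ : D →L[ℝ] E₁) (π₂ : D →L[ℝ] E₂)
    {C₀ : ℝ} (hC : ∀ x, ‖x‖ ≤ C₀ * max ‖π₁ x‖ ‖π₂ x‖) (k n : ℕ) :
    ∃ C : ℝ, ∀ x, ‖x‖ ^ k * ‖iteratedFDeriv ℝ n (fun x => f (π₁ x) * g (π₂ x)) x‖ ≤ C := by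
  refine ⟨|C₀| ^ k * ∑ i ∈ Finset.range (n + 1), (n.choose i : ℝ) * (‖π₁‖ ^ i * ‖π₂‖ ^ (n - i)) *
      (SchwartzMap.seminorm ℝ k i f * SchwartzMap.seminorm ℝ 0 (n - i) g
        + SchwartzMap.seminorm ℝ 0 i f * SchwartzMap.seminorm ℝ k (n - i) g), fun x => ?_⟩
  have hf : ContDiff ℝ ∞ (fun x => f (π₁ x)) := (f.smooth ⊤).comp π₁.contDiff
  have hg : ContDiff ℝ ∞ (fun x => g (π₂ x)) := (g.smooth ⊤).comp π₂.contDiff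
  have h1 : ∀ i, ‖iteratedFDeriv ℝ i (fun x => f (π₁ x)) x‖
      ≤ ‖iteratedFDeriv ℝ i f (π₁ x)‖ * ‖π₁‖ ^ i := by
    intro i
    rw [show (fun x => f (π₁ x)) = f ∘ π₁ from rfl,
      π₁.iteratedFDeriv_comp_right (f.smooth ⊤) x (i := i) (mod_cast le_top)]
    refine (ContinuousMultilinearMap.norm_compContinuousLinearMap_le _ _).trans ?_
    simp
  have h2 : ∀ i, ‖iteratedFDeriv ℝ i (fun x => g (π₂ x)) x‖
      ≤ ‖iteratedFDeriv ℝ i g (π₂ x)‖ * ‖π₂‖ ^ i := by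
    intro i
    rw [show (fun x => g (π₂ x)) = g ∘ π₂ from rfl,
      π₂.iteratedFDeriv_comp_right (g.smooth ⊤) x (i := i) (mod_cast le_top)]
    refine (ContinuousMultilinearMap.norm_compContinuousLinearMap_le _ _).trans ?_
    simp
  have hx : ‖x‖ ^ k ≤ |C₀| ^ k * (‖π₁ x‖ ^ k + ‖π₂ x‖ ^ k) := by
    have h : ‖x‖ ≤ |C₀| * max ‖π₁ x‖ ‖π₂ x‖ :=
      (hC x).trans (mul_le_mul_of_nonneg_right (le_abs_self _) (by positivity))
    have hm : (max ‖π₁ x‖ ‖π₂ x‖) ^ k ≤ ‖π₁ x‖ ^ k + ‖π₂ x‖ ^ k := by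
      rcases le_total ‖π₁ x‖ ‖π₂ x‖ with h' | h'
      · rw [max_eq_right h']; exact le_add_of_nonneg_left (by positivity)
      · rw [max_eq_left h']; exact le_add_of_nonneg_right (by positivity)
    calc ‖x‖ ^ k ≤ (|C₀| * max ‖π₁ x‖ ‖π₂ x‖) ^ k := pow_le_pow_left₀ (norm_nonneg _) h k
      _ = |C₀| ^ k * (max ‖π₁ x‖ ‖π₂ x‖) ^ k := mul_pow _ _ _
      _ ≤ |C₀| ^ k * (‖π₁ x‖ ^ k + ‖π₂ x‖ ^ k) := by gcongr
  have hs₁ : ∀ i, 0 ≤ SchwartzMap.seminorm ℝ k i f := fun i => apply_nonneg _ _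
  have hs₂ : ∀ i, 0 ≤ SchwartzMap.seminorm ℝ 0 i f := fun i => apply_nonneg _ _
  have hs₃ : ∀ i, 0 ≤ SchwartzMap.seminorm ℝ k i g := fun i => apply_nonneg _ _
  have hs₄ : ∀ i, 0 ≤ SchwartzMap.seminorm ℝ 0 i g := fun i => apply_nonneg _ _
  calc ‖x‖ ^ k * ‖iteratedFDeriv ℝ n (fun x => f (π₁ x) * g (π₂ x)) x‖
      ≤ (|C₀| ^ k * (‖π₁ x‖ ^ k + ‖π₂ x‖ ^ k)) * ∑ i ∈ Finset.range (n + 1), (n.choose i : ℝ)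
          * ‖iteratedFDeriv ℝ i (fun x => f (π₁ x)) x‖
          * ‖iteratedFDeriv ℝ (n - i) (fun x => g (π₂ x)) x‖ := by
        gcongr
        exact norm_iteratedFDeriv_mul_le hf hg x (mod_cast le_top)
    _ ≤ (|C₀| ^ k * (‖π₁ x‖ ^ k + ‖π₂ x‖ ^ k)) * ∑ i ∈ Finset.range (n + 1), (n.choose i : ℝ)
          * (‖iteratedFDeriv ℝ i f (π₁ x)‖ * ‖π₁‖ ^ i)
          * (‖iteratedFDeriv ℝ (n - i) g (π₂ x)‖ * ‖π₂‖ ^ (n - i)) := by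
        gcongr with i hi
        · exact h1 i
        · exact h2 (n - i)
    _ = |C₀| ^ k * ∑ i ∈ Finset.range (n + 1), (n.choose i : ℝ) * (‖π₁‖ ^ i * ‖π₂‖ ^ (n - i)) *
          ((‖π₁ x‖ ^ k * ‖iteratedFDeriv ℝ i f (π₁ x)‖) * ‖iteratedFDeriv ℝ (n - i) g (π₂ x)‖
            + ‖iteratedFDeriv ℝ i f (π₁ x)‖
              * (‖π₂ x‖ ^ k * ‖iteratedFDeriv ℝ (n - i) g (π₂ x)‖)) := by
        rw [mul_assoc, Finset.mul_sum, Finset.mul_sum, Finset.mul_sum]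
        refine Finset.sum_congr rfl fun i _ => ?_
        ring
    _ ≤ _ := by
        gcongr with i hi
        · exact le_seminorm ℝ k i f _
        · exact norm_iteratedFDeriv_le_seminorm ℝ g _ _
        · exact norm_iteratedFDeriv_le_seminorm ℝ f _ _
        · exact le_seminorm ℝ k _ g _

/-- Product of two Schwartz functions pulled back along continuous linear maps `π₁ : D → E₁`,
`π₂ : D → E₂` which jointly control the norm of `D` (`‖x‖ ≤ C * max ‖π₁ x‖ ‖π₂ x‖`, e.g. the two
projections of a product): the Schwartz function `x ↦ f (π₁ x) * g (π₂ x)` on `D`. This is the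
tensor product `f ⊗ g` of OS 1973 §2 in coordinate-free form. [cite: OS1973, §2 in coordinate-free form] -/
def mulComp (f : 𝓢(E₁, 𝕜)) (g : 𝓢(E₂, 𝕜)) (π₁ : D →L[ℝ] E₁) (π₂ : D →L[ℝ] E₂)
    (h : ∃ C₀ : ℝ, ∀ x, ‖x‖ ≤ C₀ * max ‖π₁ x‖ ‖π₂ x‖) : 𝓢(D, 𝕜) where
  toFun x := f (π₁ x) * g (π₂ x)
  smooth' := ((f.smooth ⊤).comp π₁.contDiff).mul ((g.smooth ⊤).comp π₂.contDiff)
  decay' k n := by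
    obtain ⟨C₀, hC⟩ := h
    exact decay_mul_comp f g π₁ π₂ hC k n

/-- `mulComp f g π₁ π₂ h x = f (π₁ x) * g (π₂ x)`. [folklore] -/
@[simp]
theorem mulComp_apply (f : 𝓢(E₁, 𝕜)) (g : 𝓢(E₂, 𝕜)) (π₁ : D →L[ℝ] E₁) (π₂ : D →L[ℝ] E₂)
    (h : ∃ C₀ : ℝ, ∀ x, ‖x‖ ≤ C₀ * max ‖π₁ x‖ ‖π₂ x‖) (x : D) :
    mulComp f g π₁ π₂ h x = f (π₁ x) * g (π₂ x) := rfl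

/-- The constant Schwartz function on a trivial (zero-dimensional) space, e.g. `Fin 0 → E`; used
as the empty tensor product `⨂_{i : Fin 0} fᵢ = 1`. [folklore] -/
def constOfSubsingleton [Subsingleton D] (c : 𝕜) : 𝓢(D, 𝕜) where
  toFun _ := c
  smooth' := contDiff_const
  decay' k n := by
    refine ⟨‖c‖, fun x => ?_⟩
    have hx : ‖x‖ ^ k ≤ 1 := by
      rw [Subsingleton.elim x 0, norm_zero]
      exact pow_le_one₀ le_rfl zero_le_one
    rcases eq_or_ne n 0 with rfl | hn
    · rw [norm_iteratedFDeriv_zero]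
      exact (mul_le_of_le_one_left (norm_nonneg _) hx)
    · simp [iteratedFDeriv_const_of_ne hn]

/-- `constOfSubsingleton c x = c`. [folklore] -/
@[simp]
theorem constOfSubsingleton_apply [Subsingleton D] (c : 𝕜) (x : D) :
    constOfSubsingleton (D := D) c x = c := rfl

end MulComp

section Tensor

variable {𝕜 : Type*} [RCLike 𝕜]
variable {E : Type*} [NormedAddCommGroup E] [NormedSpace ℝ E]

/-- The restriction `x ↦ x ∘ ι` along a map of index types, as a continuous `ℝ`-linear map
`(β → E) →L[ℝ] (α → E)` (an instance of `ContinuousLinearMap.pi` / `proj`). [folklore] -/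
def restrictCLM {α β : Type*} (ι : α → β) : (β → E) →L[ℝ] (α → E) :=
  ContinuousLinearMap.pi fun a => ContinuousLinearMap.proj (ι a)

/-- `restrictCLM ι x = x ∘ ι`. [folklore] -/
@[simp]
theorem restrictCLM_apply {α β : Type*} (ι : α → β) (x : β → E) :
    restrictCLM (E := E) ι x = x ∘ ι := rfl

/-- The tensor product in appended variables, `(F ⊗ G)(x) = F (x ∘ Fin.castAdd m) *
G (x ∘ Fin.natAdd n)` for `x : Fin (n + m) → E`, as a Schwartz function (OS 1973 §2, `f × g` in the
reflection-positivity condition (E2); GJ §6.1). [cite: OS1973, §2   f × g  in the reflection-positivity] -/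
def appendTensor {n m : ℕ} (F : 𝓢((Fin n → E), 𝕜)) (G : 𝓢((Fin m → E), 𝕜)) :
    𝓢((Fin (n + m) → E), 𝕜) :=
  mulComp F G (restrictCLM (Fin.castAdd m)) (restrictCLM (Fin.natAdd n)) ⟨1, fun x => by
    rw [one_mul, pi_norm_le_iff_of_nonneg (by positivity)]
    intro i
    induction i using Fin.addCases with
    | left j => exact (norm_le_pi_norm (x ∘ Fin.castAdd m) j).trans (le_max_left _ _)
    | right j => exact (norm_le_pi_norm (x ∘ Fin.natAdd n) j).trans (le_max_right _ _)⟩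

/-- `appendTensor F G x = F (x ∘ Fin.castAdd m) * G (x ∘ Fin.natAdd n)`. [folklore] -/
@[simp]
theorem appendTensor_apply {n m : ℕ} (F : 𝓢((Fin n → E), 𝕜)) (G : 𝓢((Fin m → E), 𝕜))
    (x : Fin (n + m) → E) :
    appendTensor F G x = F (x ∘ Fin.castAdd m) * G (x ∘ Fin.natAdd n) := rfl

/-- The tensor product `f₀ ⊗ ⋯ ⊗ f_{n-1}` of one-variable Schwartz functions,
`(tensorFin f)(x) = ∏ᵢ fᵢ (xᵢ)` on `Fin n → E` (OS 1973 §2–3; GJ §6.1), defined by recursion on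
`n`: the empty tensor is the constant `1`, and `f₀ ⊗ ⋯ ⊗ fₙ = (f₀ ⊗ ⋯ ⊗ f_{n-1}) ⊗ fₙ` via
`mulComp` along `x ↦ x ∘ Fin.castSucc` and `x ↦ x (Fin.last n)`. [cite: OS1973, §2–3] -/
def tensorFin : (n : ℕ) → (Fin n → 𝓢(E, 𝕜)) → 𝓢((Fin n → E), 𝕜)
  | 0, _ => constOfSubsingleton 1
  | n + 1, f =>
    mulComp (tensorFin n fun i => f i.castSucc) (f (Fin.last n)) (restrictCLM Fin.castSucc)
      (ContinuousLinearMap.proj (Fin.last n)) ⟨1, fun x => by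
        rw [one_mul, pi_norm_le_iff_of_nonneg (by positivity)]
        intro i
        induction i using Fin.lastCases with
        | last => exact le_max_right _ _
        | cast j => exact (norm_le_pi_norm (x ∘ Fin.castSucc) j).trans (le_max_left _ _)⟩

/-- `tensorFin (n + 1) f x = tensorFin n (f ∘ castSucc) (x ∘ castSucc) * f (last n) (x (last n))`
(unfolding of the recursion). [folklore] -/
theorem tensorFin_succ_apply {n : ℕ} (f : Fin (n + 1) → 𝓢(E, 𝕜)) (x : Fin (n + 1) → E) :
    tensorFin (n + 1) f x
      = tensorFin n (fun i => f i.castSucc) (x ∘ Fin.castSucc) * f (Fin.last n) (x (Fin.last n)) :=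
  rfl

/-- `tensorFin n f x = ∏ᵢ fᵢ (xᵢ)`: the recursive construction is the tensor product
(OS 1973 §2). [cite: OS1973, §2] -/
@[simp]
theorem tensorFin_apply {n : ℕ} (f : Fin n → 𝓢(E, 𝕜)) (x : Fin n → E) :
    tensorFin n f x = ∏ i, f i (x i) := by
  induction n with
  | zero => simp [tensorFin]
  | succ n ih => rw [tensorFin_succ_apply, ih, Fin.prod_univ_castSucc]; rfl

end Tensor

end SchwartzMap

namespace Literature.MathematicalPhysics.QuantumLattice

/-! ### Witness predicates for tensor products -/

section Witness

variable {E : Type*} [NormedAddCommGroup E] [NormedSpace ℝ E]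
variable {n m : ℕ}

/-- `F` is the tensor product `f₀ ⊗ ⋯ ⊗ f_{n-1}` of the one-point test functions `f i`:
`F (x₀, …, x_{n-1}) = ∏ᵢ fᵢ (xᵢ)` for all `x` (OS 1973 §2–3; GJ §6.1). Witness predicate
(outline A-D1, R1): statements quantify over such `F` instead of fixing a construction; see
`isTensorOf_tensorFin` / `exists_isTensorOf` for non-vacuity. [cite: OS1973, §2–3] -/
def IsTensorOf (F : 𝓢((Fin n → E), ℂ)) (f : Fin n → 𝓢(E, ℂ)) : Prop :=
  ∀ x, F x = ∏ i, f i (x i)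

/-- `H` is the tensor product `F ⊗ G` in appended variables:
`H (x₁, …, x_{n+m}) = F (x₁, …, xₙ) * G (x_{n+1}, …, x_{n+m})`, with the `Fin.append` splitting
`Fin.castAdd m` / `Fin.natAdd n` (OS 1973 §2, `f × g` in (E2); GJ §6.1). Witness predicate. [cite: OS1973, §2   f × g  in (E2] -/
def IsAppendTensorOf (H : 𝓢((Fin (n + m) → E), ℂ)) (F : 𝓢((Fin n → E), ℂ))
    (G : 𝓢((Fin m → E), ℂ)) : Prop :=
  ∀ x, H x = F (x ∘ Fin.castAdd m) * G (x ∘ Fin.natAdd n)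

/-- The recursive construction `SchwartzMap.tensorFin` is a tensor product in the sense of
`IsTensorOf` (OS 1973 §2). [cite: OS1973, §2] -/
theorem isTensorOf_tensorFin (f : Fin n → 𝓢(E, ℂ)) : IsTensorOf (SchwartzMap.tensorFin n f) f :=
  fun x => SchwartzMap.tensorFin_apply f x

/-- `SchwartzMap.appendTensor F G` is a tensor product in the sense of `IsAppendTensorOf`
(OS 1973 §2). [cite: OS1973, §2] -/
theorem isAppendTensorOf_appendTensor (F : 𝓢((Fin n → E), ℂ)) (G : 𝓢((Fin m → E), ℂ)) :
    IsAppendTensorOf (SchwartzMap.appendTensor F G) F G :=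
  fun x => SchwartzMap.appendTensor_apply F G x

/-- Tensor products of one-point test functions exist in `𝓢((Fin n → E), ℂ)` (OS 1973 §2;
outline R1): the witness predicate `IsTensorOf` is non-vacuous. [cite: OS1973, §2] -/
theorem exists_isTensorOf (f : Fin n → 𝓢(E, ℂ)) : ∃ F : 𝓢((Fin n → E), ℂ), IsTensorOf F f :=
  ⟨_, isTensorOf_tensorFin f⟩

/-- Tensor products `F ⊗ G` in appended variables exist (OS 1973 §2; outline R1): the witness
predicate `IsAppendTensorOf` is non-vacuous. [cite: OS1973, §2] -/
theorem exists_isAppendTensorOf (F : 𝓢((Fin n → E), ℂ)) (G : 𝓢((Fin m → E), ℂ)) :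
    ∃ H : 𝓢((Fin (n + m) → E), ℂ), IsAppendTensorOf H F G :=
  ⟨_, isAppendTensorOf_appendTensor F G⟩

/-- Tensor products are unique as functions: two witnesses of `IsTensorOf · f` coincide. [folklore] -/
theorem IsTensorOf.unique {F F' : 𝓢((Fin n → E), ℂ)} {f : Fin n → 𝓢(E, ℂ)}
    (hF : IsTensorOf F f) (hF' : IsTensorOf F' f) : F = F' := by
  ext x
  rw [hF x, hF' x]

/-- Permuting the arguments of a tensor product permutes the factors:
`(f₀ ⊗ ⋯ ⊗ f_{n-1})^σ = f_{σ⁻¹ 0} ⊗ ⋯ ⊗ f_{σ⁻¹ (n-1)}` (OS 1973 §2, `f^π`; symmetry (E3)). [cite: OS1973, §2   f^π] -/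
theorem IsTensorOf.permTest {F : 𝓢((Fin n → E), ℂ)} {f : Fin n → 𝓢(E, ℂ)} (hF : IsTensorOf F f)
    (σ : Equiv.Perm (Fin n)) : IsTensorOf (permTest σ F) (f ∘ σ.symm) := by
  intro x
  rw [permTest_apply, hF]
  exact Fintype.prod_equiv σ _ _ fun i => by simp

end Witness

/-! ### Conjugation and the Osterwalder–Schrader adjoint -/

section Star

variable {X : Type*} [NormedAddCommGroup X] [NormedSpace ℝ X]

/-- Pointwise complex conjugation of a complex test function, `f ↦ conj ∘ f`, as a continuous
`ℝ`-linear map (`SchwartzMap.postcompCLM` of `Complex.conjCLE`); OS 1973 §2 (`f ↦ f⁻`, `f*`). [cite: OS1973, §2 ( f ↦ f⁻    f] -/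
def starTest : 𝓢(X, ℂ) →L[ℝ] 𝓢(X, ℂ) :=
  SchwartzMap.postcompCLM (𝕜 := ℝ) (Complex.conjCLE : ℂ →L[ℝ] ℂ)

/-- `starTest f x = conj (f x)`. [folklore] -/
@[simp]
theorem starTest_apply (f : 𝓢(X, ℂ)) (x : X) : starTest f x = conj (f x) := rfl

/-- Conjugation is an involution: `starTest (starTest f) = f`. [folklore] -/
@[simp]
theorem starTest_starTest (f : 𝓢(X, ℂ)) : starTest (starTest f) = f := by
  ext x
  simp

variable {d : ℕ} [NeZero d] {n : ℕ}

/-- The Osterwalder–Schrader adjoint of an `n`-point test function on `(ℝ^d)^n`: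
`(osAdjoint F)(x₁, …, xₙ) = conj F (θ xₙ, …, θ x₁)`, i.e. `Θ F*` with
`F*(x₁, …, xₙ) = conj F(xₙ, …, x₁)` and `θ` the time reflection (OS 1973 §2, (2.4), and the
reflection-positivity condition (E2), (4.2)). Built as
`starTest ∘ thetaMulti d ∘ permTest Fin.revPerm`. [cite: OS1973, §2  (2.4] -/
def osAdjoint (F : 𝓢((Fin n → EuclideanSpace ℝ (Fin d)), ℂ)) :
    𝓢((Fin n → EuclideanSpace ℝ (Fin d)), ℂ) :=
  starTest (thetaMulti d (permTest Fin.revPerm F))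

/-- `osAdjoint F x = conj (F (fun i => θ (x (Fin.rev i))))`. [folklore] -/
@[simp]
theorem osAdjoint_apply (F : 𝓢((Fin n → EuclideanSpace ℝ (Fin d)), ℂ))
    (x : Fin n → EuclideanSpace ℝ (Fin d)) :
    osAdjoint F x = conj (F fun i => timeReflection d (x (Fin.rev i))) := by
  simp [osAdjoint, Function.comp_def]

end Star

/-! ### Schwinger families -/

section Schwinger

variable (E : Type*) [NormedAddCommGroup E] [NormedSpace ℝ E]

/-- A *Schwinger family*: a sequence of tempered distributions `𝔖ₙ ∈ 𝒮'((E)^n)`, `n ∈ ℕ`,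
here continuous `ℂ`-linear functionals on `𝓢((Fin n → E), ℂ)` (OS 1973 §3, the sequence
`{𝔖ₙ}`; GJ §6.1). [cite: OS1973, §3  the sequence  {𝔖ₙ}] -/
abbrev SchwingerFamily : Type _ := (n : ℕ) → (𝓢((Fin n → E), ℂ) →L[ℂ] ℂ)

variable {E}

/-- `S` is the Schwinger family of the law `μ` on field configurations: on tensor products of
(complexified) real test functions it reproduces the moments,
`𝔖ₙ (f₁ ⊗ ⋯ ⊗ fₙ) = ∫ ∏ᵢ ω(fᵢ) dμ(ω)` (GJ §6.1, (6.1.4); OS 1973 §3). Uses the witness predicate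
`IsTensorOf` (outline A-D1). [cite: OS1973, §3] -/
def IsSchwingerFamilyOf (μ : Measure (FieldConfig E)) (S : SchwingerFamily E) : Prop :=
  ∀ (n : ℕ) (f : Fin n → 𝓢(E, ℝ)) (F : 𝓢((Fin n → E), ℂ)),
    IsTensorOf F (fun i => ofRealTest (f i)) → S n F = (moment μ n f : ℂ)

namespace SchwingerFamily

/-- Symmetry condition (E3) of Osterwalder–Schrader (1973 §3): `𝔖ₙ (f^π) = 𝔖ₙ (f)` for every
permutation `π` of the `n` arguments. [cite: OsterwalderSchrader1973, §3] -/
def IsSymmetric (S : SchwingerFamily E) : Prop :=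
  ∀ (n : ℕ) (σ : Equiv.Perm (Fin n)) (F : 𝓢((Fin n → E), ℂ)), S n (permTest σ F) = S n F

/-- The smeared two-point Schwinger function `𝔖₂ (f ⊗ g)` of a Schwinger family (OS 1973 §3;
GJ §6.1), evaluated on the real tensor product `SchwartzMap.tensorFin 2 ![f, g]`. [cite: OS1973, §3] -/
def twoPoint (S : SchwingerFamily E) (f g : 𝓢(E, ℂ)) : ℂ :=
  S 2 (SchwartzMap.tensorFin 2 ![f, g])

/-- `twoPoint` does not depend on the chosen tensor-product witness. [folklore] -/
theorem twoPoint_eq_of_isTensorOf (S : SchwingerFamily E) (f g : 𝓢(E, ℂ))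
    {F : 𝓢((Fin 2 → E), ℂ)} (hF : IsTensorOf F ![f, g]) : S.twoPoint f g = S 2 F := by
  rw [twoPoint, (isTensorOf_tensorFin ![f, g]).unique hF]

/-- For the Schwinger family of a law `μ`, the two-point function on complexified real test
functions is the second moment `∫ ω(f) ω(g) dμ` (GJ §6.1). [folklore] -/
theorem twoPoint_eq_moment {μ : Measure (FieldConfig E)} {S : SchwingerFamily E}
    (hS : IsSchwingerFamilyOf μ S) (f g : 𝓢(E, ℝ)) :
    S.twoPoint (ofRealTest f) (ofRealTest g) = (moment μ 2 ![f, g] : ℂ) := by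
  refine hS 2 ![f, g] _ fun x => ?_
  rw [SchwartzMap.tensorFin_apply]
  congr 1
  ext i
  fin_cases i <;> rfl

end SchwingerFamily

/-- **Schwinger functions of a measure** (GJ §6.1, Prop. 6.1.4 ff.; OS 1973 §3; kernel theorem,
Gel'fand–Vilenkin IV §1.3). If a probability law `μ` on `𝒮'(E)` (finite-dimensional `E`) has all
moments and each moment functional `(f₁, …, fₙ) ↦ ∫ ∏ᵢ ω(fᵢ) dμ` is jointly continuous on
`𝓢(E, ℝ)ⁿ`, then there is a unique Schwinger family `𝔖ₙ ∈ 𝒮'(Eⁿ)` with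
`𝔖ₙ (f₁ ⊗ ⋯ ⊗ fₙ) = ∫ ∏ᵢ ω(fᵢ) dμ` (existence: Schwartz nuclear theorem; uniqueness: density of
finite sums of tensor products). Known theorem; proof deferred. [cite: OS1973, §3] -/
def existsUnique_schwingerFamilyOf : Prop :=
  ∀ [FiniteDimensional ℝ E] (μ : Measure (FieldConfig E)) [IsProbabilityMeasure μ] (hμ : HasAllMoments μ) (hcont : ∀ n : ℕ, Continuous fun f : Fin n → 𝓢(E, ℝ) => moment μ n f),
    ∃! S : SchwingerFamily E, IsSchwingerFamilyOf μ S

end Schwinger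

end Literature.MathematicalPhysics.QuantumLattice
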